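import Literature.MathematicalPhysics.QuantumFieldTheory.Balaban1983to89.T4DobrushinTensorisation
import HarnessLib

/-!
# The one-site Gibbs kernels of a CONTINUOUS bounded energy depend continuously on the boundary
# condition (Feller / quasilocality, finite-volume continuous-spin form)

[topic MathematicalPhysics/QuantumFieldTheory]

`T4DobrushinTensorisation.lean` §7 defines, for a product reference law `⊗ᵢ πᵢ` of probability
measures and a bounded measurable energy `A` on `Π i, E i`, the one-site Gibbs kernels
`gibbsKernel π A i ξ (dy) = exp (−A (update ξ i y)) πᵢ(dy) / Zᵢ(ξ)` and proves that they are
Markov, local and resampling-invariant for the Gibbs law (the DLR identities). This file adds the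
topological counterpart: if the single-spin spaces are topological and `A` is moreover
CONTINUOUS, then for every bounded continuous — indeed every bounded measurable — `f`, the map
`ξ ↦ ∫ f d(gibbsKernel π A i ξ)` is continuous (`continuous_integral_gibbsKernel`,
`continuous_integral_gibbsKernel_of_measurable`; also `continuous_siteZ`). This is the
continuous-spin, finite-volume form of QUASILOCALITY of a Gibbsian specification («each kernel
`π_Λ` is continuous with respect to its boundary condition», Friedli–Velenik Def. 6.25; Gibbsian
specifications of absolutely summable potentials are quasilocal, Lemma 6.28), proved by dominated
convergence (`MeasureTheory.continuous_of_dominated`: the integrand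
`exp (−A (update ξ i y)) f(y)` is continuous in `ξ` and bounded by `e^a ‖f‖`).

Use (tree): it is the continuity hypothesis under which the one-site couplings of Dobrushin's
coupling construction can be selected measurably
(`Probability/TransportMaps/DobrushinCouplingContinuous.lean`,
`MeasureTheory/OptimalTransport/MeasurableOptimalCoupling.lean`), e.g. for lattice gauge actions
`A = −β · Wilson + W` on `SU(N)^{links}`, which are continuous.

## References
* S. Friedli, Y. Velenik, *Statistical Mechanics of Lattice Systems* (CUP 2017), Def. 6.25
  (quasilocal specification), Lemma 6.28 (Gibbsian specifications are quasilocal). [FriedliVelenik2017]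
-/

noncomputable section

open MeasureTheory ProbabilityTheory Function Filter
open scoped ENNReal NNReal Topology BoundedContinuousFunction

namespace Literature.MathematicalPhysics.QuantumFieldTheory.Balaban1983to89.T4DobrushinTensorisation

universe u v

variable {ι : Type u} [Fintype ι] [DecidableEq ι] {E : ι → Type v} [∀ i, MeasurableSpace (E i)]
  [∀ i, TopologicalSpace (E i)] [∀ i, FirstCountableTopology (E i)]
variable {π : (i : ι) → Measure (E i)} [∀ i, IsProbabilityMeasure (π i)]
  {A : ((j : ι) → E j) → ℝ}

/-- Dominated-convergence core: for a continuous bounded energy `A` and a bounded measurable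
`f` on `E i`, the numerator `ξ ↦ ∫ exp (−A (update ξ i y)) f(y) dπᵢ(y)` is continuous in the
boundary condition `ξ`. [cite: FriedliVelenik2017, Lemma 6.28] -/
theorem continuous_integral_exp_neg_energy_mul (hAm : Measurable A) (hAc : Continuous A)
    {a : ℝ} (hAb : ∀ ξ, |A ξ| ≤ a) (i : ι) {f : E i → ℝ} (hfm : Measurable f) {M : ℝ}
    (hfM : ∀ y, |f y| ≤ M) :
    Continuous fun ξ : (j : ι) → E j => ∫ y, Real.exp (-A (update ξ i y)) * f y ∂π i := by
  refine continuous_of_dominated (bound := fun _ => Real.exp a * M) (fun ξ => ?_) (fun ξ => ?_)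
    (integrable_const _) ?_
  · exact ((Real.measurable_exp.comp (hAm.comp (measurable_update ξ)).neg).mul hfm)
      |>.aestronglyMeasurable
  · refine ae_of_all _ fun y => ?_
    rw [Real.norm_eq_abs, abs_mul, abs_of_pos (Real.exp_pos _)]
    exact mul_le_mul (exp_neg_energy_bounds hAb _).2 (hfM y) (abs_nonneg _) (Real.exp_pos _).le
  · refine ae_of_all _ fun y => ?_
    exact (Real.continuous_exp.comp
      ((hAc.comp (continuous_id.update i continuous_const)).neg)).mul continuous_const

/-- The one-site partition function `Zᵢ(ξ)` is continuous in `ξ` for a continuous bounded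
energy. [cite: FriedliVelenik2017, Lemma 6.28] -/
theorem continuous_siteZ (hAm : Measurable A) (hAc : Continuous A) {a : ℝ} (hAb : ∀ ξ, |A ξ| ≤ a)
    (i : ι) : Continuous (siteZ π A i) := by
  have h := continuous_integral_exp_neg_energy_mul (π := π) hAm hAc hAb i
    (f := fun _ => (1 : ℝ)) measurable_const (M := 1) (fun _ => by simp)
  simp only [mul_one] at h
  exact h

/-- **Quasilocality / Feller continuity of the one-site Gibbs kernel, strong form**: for a
continuous bounded energy `A` and every bounded MEASURABLE `f`, `ξ ↦ ∫ f d(gibbsKernel π A i ξ)`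
is continuous («each kernel is continuous with respect to its boundary condition»; here the
finite-volume continuous-spin analogue of Friedli–Velenik's Lemma 6.28, by dominated
convergence). [cite: FriedliVelenik2017, Def. 6.25 and Lemma 6.28] -/
theorem continuous_integral_gibbsKernel_of_measurable (hAm : Measurable A) (hAc : Continuous A)
    {a : ℝ} (hAb : ∀ ξ, |A ξ| ≤ a) (i : ι) {f : E i → ℝ} (hfm : Measurable f) {M : ℝ}
    (hfM : ∀ y, |f y| ≤ M) :
    Continuous fun ξ : (j : ι) → E j => ∫ y, f y ∂(gibbsKernel π A i ξ) := by
  have e : ∀ ξ : (j : ι) → E j, ∫ y, f y ∂(gibbsKernel π A i ξ) =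
      (∫ y, Real.exp (-A (update ξ i y)) * f y ∂π i) / siteZ π A i ξ := by
    intro ξ
    rw [integral_gibbsKernel hAm hAb, ← integral_div]
    refine integral_congr_ae (ae_of_all _ fun y => ?_)
    simp only [gibbsDensity]
    ring
  simp_rw [e]
  exact (continuous_integral_exp_neg_energy_mul hAm hAc hAb i hfm hfM).div
    (continuous_siteZ hAm hAc hAb i) fun ξ => (siteZ_pos hAm hAb i ξ).ne'

/-- **Weak continuity of the one-site Gibbs kernel** (the form used to select one-site couplings
measurably): for every bounded continuous `f`, `ξ ↦ ∫ f d(gibbsKernel π A i ξ)` is continuous.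
[cite: FriedliVelenik2017, Def. 6.25 and Lemma 6.28] -/
theorem continuous_integral_gibbsKernel [∀ j, OpensMeasurableSpace (E j)] (hAm : Measurable A)
    (hAc : Continuous A) {a : ℝ} (hAb : ∀ ξ, |A ξ| ≤ a) (i : ι) (f : E i →ᵇ ℝ) :
    Continuous fun ξ : (j : ι) → E j => ∫ y, f y ∂(gibbsKernel π A i ξ) :=
  continuous_integral_gibbsKernel_of_measurable hAm hAc hAb i f.continuous.measurable
    (M := ‖f‖) fun y => by simpa [Real.norm_eq_abs] using f.norm_coe_le_norm y

end Literature.MathematicalPhysics.QuantumFieldTheory.Balaban1983to89.T4DobrushinTensorisation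

end
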